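import Literature.AlgebraicGeometry.HodgeTheory.ComplexGysin

/-!
# Crux `TwinTransportRMPicardTwo` (stmt-HodgeConjecture-15067), line `Sketch` — stub
# `stub_hecke_algebra`: the dihedral Hecke identity in Gysin calculus

Helper file (`--supports stmt-HodgeConjecture-15067`) for the line `Sketch` (dihedral Hecke octagon)
of the crux
`Summit.HodgeConjecture.HodgeConjecture.Theses.NikulinTwinTransport.TwinTransportRMPicardTwo`.

Let `π : W ⟶ S` be a morphism of smooth projective complex surfaces, `σ, σ' : W ⟶ W` morphisms
inverse to each other whose pull-backs act trivially on `H⁴(W(ℂ); ℂ)`, `c : ℂ`, and let `T` be the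
Hecke operator `T = c • π₊ (σ^* + σ'^*) π^*` on `H²(S(ℂ); ℂ)` (Gysin morphism `π₊ = complexGysin μ`
of an orientation family `μ` with Poincaré duality; pull-backs `complexBetti.map`). Then:

* `T` is cup-self-adjoint, `T x ∪ y = x ∪ T y`: by the projection formula
  `x ∪ π₊ w = π₊ (π^* x ∪ w)` (`complexGysin_cup`, Fulton (6)), multiplicativity of pull-backs
  (`cupProduct_map`), `σ^* σ'^* = 1`, the triviality of `σ^*` on `H⁴(W)` and graded commutativity
  in the even degrees `H²`, `H⁴` (`cupProduct_gradedComm_holds`):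
  `π₊(π^*y ∪ σ^*π^*x) = π₊ σ^*(σ'^*π^*y ∪ π^*x) = π₊(π^*x ∪ σ'^*π^*y)`, and symmetrically with
  `σ ↔ σ'`; summing the two terms gives the claim. No transfer hypothesis is used here.
* if moreover `π^* ∘ T = (σ^* + σ'^*) ∘ π^*` (transfer) and `c • π₊ π^* = 1`, then `T (T x) = 2 x`
  for every `x` with `σ^{*4} π^* x = -π^* x`: `π^* T T x = (σ^* + σ'^*)² π^* x
  = σ^{*2}π^*x + 2 π^*x + σ'^{*2}π^*x = 2 π^*x` (`σ'^{*2} = -σ^{*2}` on `π^*x` from `σ^{*4} = -1`),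
  and applying `c • π₊` gives `T T x = 2x` (`(s + s⁻¹)² = 2` on `s⁴ = -1`, `√2 = ζ₈ + ζ₈⁻¹`).

This is the Gysin-calculus half of van Geemen–Schütt's dihedral construction of real
multiplication by `√2` on K3 surfaces (the correspondence `π₊ σ^* π^*` of a cover with an
automorphism of order `8` on the transcendental lattice); the two statements are packaged exactly as
the registered stub `stub_hecke_algebra` of the skeleton
`Cruxes/TwinTransportRMPicardTwo/Lines/Sketch.lean`.
The proofs are pure linear algebra over the proved tree theorems `complexGysin_cup`,
`complexBetti.map_comp`, `complexBetti.map_id`, `cupProduct_map`, `cupProduct_gradedComm_holds`.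

## References

* [VanGeemenSchuett2023] B. van Geemen, M. Schütt, arXiv:2310.05196, §4.7–4.8 (dihedral Hecke
  correspondences, `√2 = ζ₈ + ζ₈⁻¹`).
* [FultonYoungTableaux1997] W. Fulton, *Young Tableaux*, CUP 1997, Appendix B §B.1 (1), (5), (6)
  (pull-backs, Gysin morphisms, projection formula).
* [Hatcher2002] A. Hatcher, *Algebraic Topology*, CUP 2002, Prop. 3.10, Thm. 3.11.
-/

noncomputable section

set_option linter.dupNamespace false

namespace Summit.HodgeConjecture.HodgeConjecture.Theorems.NikulinTwinTransport

open CategoryTheory MonoidalCategory SemiCartesianMonoidalCategory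
open Literature.AlgebraicGeometry.Motives Literature.AlgebraicGeometry.HodgeTheory
open Literature.AlgebraicTopology.SingularHomology

section HeckeAlgebra

/-! ### Linear algebra of the Hecke operator `T = c • G (A + A') P` -/

/-- **The square of the dihedral Hecke operator.** For linear maps `P : V → U` (`π^*`),
`A, A' : U → U` inverse to each other (`σ^*`, `σ'^*`), `G : U → V` (`π₊`) and
`T = c • G (A + A') P` with transfer `P T = (A + A') P` and `c • G P = 1`:
`T (T x) = 2 x` whenever `A⁴ (P x) = -P x` (then `A'² P x = -A² P x`, so
`P T T x = A² P x + 2 P x + A'² P x = 2 P x`; `(s + s⁻¹)² = 2` for `s⁴ = -1`).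
[cite: VanGeemenSchuett2023, §4.7–4.8] -/
theorem hecke_sq_eq_two_smul_of_transfer {V U : Type*} [AddCommGroup V] [Module ℂ V]
    [AddCommGroup U] [Module ℂ U] (T : V →ₗ[ℂ] V) (P : V →ₗ[ℂ] U) (A A' : U →ₗ[ℂ] U)
    (G : U →ₗ[ℂ] V) (c : ℂ)
    (hT : ∀ x, T x = c • G (A (P x)) + c • G (A' (P x)))
    (hAA' : ∀ y, A (A' y) = y) (hA'A : ∀ y, A' (A y) = y)
    (h1 : ∀ x, P (T x) = A (P x) + A' (P x)) (h2 : ∀ x, c • G (P x) = x)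
    (x : V) (hx : A (A (A (A (P x)))) = -P x) : T (T x) = (2 : ℂ) • x := by
  have hA'A' : A' (A' (P x)) = -A (A (P x)) := by
    have h := congrArg (fun z => A' (A' z)) hx
    simp only [hA'A, map_neg] at h
    rw [h, neg_neg]
  have hPTT : P (T (T x)) = (2 : ℂ) • P x := by
    rw [h1 (T x), h1 x, map_add, map_add, hAA', hA'A, hA'A', two_smul]
    abel
  have hTT : c • G (P (T (T x))) = T (T x) := by
    rw [h1 (T x), map_add, smul_add, ← hT (T x)]
  rw [← hTT, hPTT, map_smul, smul_comm, h2]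

/-- **Cup-self-adjointness of the dihedral Hecke operator.** With cup products `cupS` on `V`
(`H²(S)`, values in `V₄ = H⁴(S)`) and `cupW` on `U` (`H²(W)`, values in `U₄ = H⁴(W)`), both
commutative (even degrees), pull-backs `P = π^*`, `A = σ^*`, `A' = σ'^*` with `A A' = 1 = A' A`,
their degree-`4` companions `A₄`, `A'₄` multiplicative (`A₄ (a ∪ b) = A a ∪ A b`) and trivial on
`U₄`, Gysin maps `G`, `G₄` with the projection formula `x ∪ G w = G₄ (P x ∪ w)`, the operator
`T = c • G (A + A') P` satisfies `T x ∪ y = x ∪ T y`: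
`G₄ (P y ∪ A P x) = G₄ A₄ (A' P y ∪ P x) = G₄ (P x ∪ A' P y)`.
[cite: VanGeemenSchuett2023, §4.7–4.8] [cite: FultonYoungTableaux1997, Appendix B §B.1 (6)] -/
theorem hecke_cup_selfAdjoint {V U V₄ U₄ : Type*} [AddCommGroup V] [Module ℂ V]
    [AddCommGroup U] [Module ℂ U] [AddCommGroup V₄] [Module ℂ V₄] [AddCommGroup U₄] [Module ℂ U₄]
    (cupS : V →ₗ[ℂ] V →ₗ[ℂ] V₄) (cupW : U →ₗ[ℂ] U →ₗ[ℂ] U₄)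
    (T : V →ₗ[ℂ] V) (P : V →ₗ[ℂ] U) (A A' : U →ₗ[ℂ] U) (A₄ A'₄ : U₄ →ₗ[ℂ] U₄)
    (G : U →ₗ[ℂ] V) (G₄ : U₄ →ₗ[ℂ] V₄) (c : ℂ)
    (hT : ∀ x, T x = c • G (A (P x)) + c • G (A' (P x)))
    (hAA' : ∀ y, A (A' y) = y) (hA'A : ∀ y, A' (A y) = y)
    (hA₄ : ∀ z, A₄ z = z) (hA'₄ : ∀ z, A'₄ z = z)
    (proj : ∀ x w, cupS x (G w) = G₄ (cupW (P x) w))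
    (commS : ∀ a b, cupS a b = cupS b a) (commW : ∀ a b, cupW a b = cupW b a)
    (mulA : ∀ a b, A₄ (cupW a b) = cupW (A a) (A b))
    (mulA' : ∀ a b, A'₄ (cupW a b) = cupW (A' a) (A' b))
    (x y : V) : cupS (T x) y = cupS x (T y) := by
  -- one Hecke term: `G (B P x) ∪ y = x ∪ G (B' P y)` for `B B' = 1`, `B₄ = 1` multiplicative
  have key : ∀ (B B' : U →ₗ[ℂ] U) (B₄ : U₄ →ₗ[ℂ] U₄), (∀ y, B (B' y) = y) → (∀ z, B₄ z = z) →
      (∀ a b, B₄ (cupW a b) = cupW (B a) (B b)) →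
      cupS (G (B (P x))) y = cupS x (G (B' (P y))) := by
    intro B B' B₄ hBB' hB₄ hmul
    have h3 : cupW (P y) (B (P x)) = B₄ (cupW (B' (P y)) (P x)) := by
      rw [hmul, hBB']
    rw [commS (G (B (P x))) y, proj y (B (P x)), proj x (B' (P y)), h3, hB₄,
      commW (B' (P y)) (P x)]
  rw [hT x, hT y]
  simp only [map_add, map_smul, LinearMap.add_apply, LinearMap.smul_apply]
  rw [key A A' A₄ hAA' hA₄ mulA, key A' A A'₄ hA'A hA'₄ mulA']
  exact add_comm _ _

/-! ### The stub -/

variable {S W : SchemeOver ℂ}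

/-- Pull-backs along morphisms inverse to each other are inverse to each other:
`τ ≫ τ' = 𝟙 W` gives `τ^* (τ'^* z) = z` on `Hᵏ(W(ℂ); ℂ)` (`(τ ≫ τ')^* = τ^* ∘ τ'^*`, `𝟙^* = 𝟙`).
[cite: FultonYoungTableaux1997, Appendix B §B.1 (1)] -/
private theorem complexBetti_map_map_of_comp_eq_id {τ τ' : W ⟶ W} (h : τ ≫ τ' = 𝟙 W) (k : ℕ)
    (z : complexBetti W k) : complexBetti.map τ k (complexBetti.map τ' k z) = z := by
  rw [← ModuleCat.comp_apply, ← complexBetti.map_comp, h, complexBetti.map_id, ModuleCat.id_apply]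

/-- `(τ ≫ π)^* x = τ^* (π^* x)` on `Hᵏ(–(ℂ); ℂ)`.
[cite: FultonYoungTableaux1997, Appendix B §B.1 (1)] -/
private theorem complexBetti_map_comp_apply (τ : W ⟶ W) (π : W ⟶ S) (k : ℕ) (x : complexBetti S k) :
    complexBetti.map (τ ≫ π) k x = complexBetti.map τ k (complexBetti.map π k x) := by
  rw [complexBetti.map_comp, ModuleCat.comp_apply]

/-- Pull-back is multiplicative: `f^* (a ∪ b) = f^* a ∪ f^* b` (Hatcher Prop. 3.10, in the
`complexBetti.map` wrapper). [cite: Hatcher2002, Prop. 3.10] -/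
private theorem complexBetti_map_cupProduct (f : W ⟶ S) {p q n : ℕ} (h : p + q = n)
    (a : complexBetti S p) (b : complexBetti S q) :
    complexBetti.map f n (cupProduct h a b) =
      cupProduct h (complexBetti.map f p a) (complexBetti.map f q b) :=
  cupProduct_map _ h a b

/-- Graded commutativity in degree `(2, 2)`: `a ∪ b = b ∪ a` for `a, b ∈ H²(S(ℂ); ℂ)` (the sign
`(-1)^{2·2} = 1`; Hatcher Thm. 3.11 via `cupProduct_gradedComm_holds`).
[cite: Hatcher2002, Thm. 3.11] -/
private theorem cupProduct_comm_two_two (a b : complexBetti S (2 * 1)) :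
    cupProduct (rfl : 2 * 1 + 2 * 1 = 2 * 2) a b =
      cupProduct (rfl : 2 * 1 + 2 * 1 = 2 * 2) b a := by
  rw [cupProduct_gradedComm_holds ℂ _ (rfl : 2 * 1 + 2 * 1 = 2 * 2) rfl]
  norm_num

/-- **Stub 2 of line `Sketch` · the dihedral Hecke identity in Gysin calculus.** For smooth
projective complex surfaces `S`, `W`, a morphism `π : W ⟶ S`, morphisms `σ, σ' : W ⟶ W` inverse to
each other with `σ^* = 1 = σ'^*` on `H⁴(W(ℂ); ℂ)`, a scalar `c` and the Hecke operator
`T x = c • π₊ ((σ ≫ π)^* x) + c • π₊ ((σ' ≫ π)^* x)` on `H²(S(ℂ); ℂ)`: granted the transfer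
identity `π^* (T x) = (σ ≫ π)^* x + (σ' ≫ π)^* x` and `c • π₊ π^* = 1`, (i) `T` is cup-self-adjoint
(projection formula `complexGysin_cup`, multiplicativity of pull-backs, graded commutativity in even
degrees; the transfer hypotheses are not used for (i)), and (ii) `T (T x) = 2 x` for every `x` with
`σ^{*4} (π^* x) = -π^* x` (`(s + s⁻¹)² = 2 + s² + s⁻² = 2` on `s⁴ = -1`: real multiplication by
`√2 = ζ₈ + ζ₈⁻¹` from a dihedral Hecke correspondence).
[cite: VanGeemenSchuett2023, §4.7–4.8] [cite: FultonYoungTableaux1997, Appendix B §B.1 (6)] -/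
theorem stub_hecke_algebra : ∀ (μ : OrientationFamily), μ.HasPoincareDuality →
    ∀ (S W : SchemeOver ℂ) (hS : IsSmoothProjective 2 S) (hW : IsSmoothProjective 2 W)
      (π : W ⟶ S) (σ σ' : W ⟶ W) (c : ℂ) (T : complexBetti S (2 * 1) →ₗ[ℂ] complexBetti S (2 * 1)),
      (∀ x : complexBetti S (2 * 1), T x =
          c • complexGysin μ hW hS π (rfl : 2 * 1 + 2 * 2 = 2 * 1 + 2 * 2)
                (complexBetti.map (σ ≫ π) (2 * 1) x) +
            c • complexGysin μ hW hS π (rfl : 2 * 1 + 2 * 2 = 2 * 1 + 2 * 2)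
                (complexBetti.map (σ' ≫ π) (2 * 1) x)) →
      σ ≫ σ' = 𝟙 W → σ' ≫ σ = 𝟙 W →
      (∀ z : complexBetti W (2 * 2), complexBetti.map σ (2 * 2) z = z) →
      (∀ z : complexBetti W (2 * 2), complexBetti.map σ' (2 * 2) z = z) →
      (∀ x : complexBetti S (2 * 1), complexBetti.map π (2 * 1) (T x) =
          complexBetti.map (σ ≫ π) (2 * 1) x + complexBetti.map (σ' ≫ π) (2 * 1) x) →
      (∀ x : complexBetti S (2 * 1),
          c • complexGysin μ hW hS π (rfl : 2 * 1 + 2 * 2 = 2 * 1 + 2 * 2)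
            (complexBetti.map π (2 * 1) x) = x) →
      (∀ x y : complexBetti S (2 * 1),
          cupProduct (rfl : 2 * 1 + 2 * 1 = 2 * 2) (T x) y =
            cupProduct (rfl : 2 * 1 + 2 * 1 = 2 * 2) x (T y)) ∧
      (∀ x : complexBetti S (2 * 1),
          complexBetti.map σ (2 * 1) (complexBetti.map σ (2 * 1) (complexBetti.map σ (2 * 1)
            (complexBetti.map σ (2 * 1) (complexBetti.map π (2 * 1) x)))) =
              -complexBetti.map π (2 * 1) x →
          T (T x) = (2 : ℂ) • x) := by
  intro μ hμ S W hS hW π σ σ' c T hT hσσ' hσ'σ hσ4 hσ'4 h1 h2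
  -- `(σ ≫ π)^* = σ^* ∘ π^*`: the operator and the transfer identity in factored form
  have hT' : ∀ x, T x =
      c • complexGysin μ hW hS π (rfl : 2 * 1 + 2 * 2 = 2 * 1 + 2 * 2)
        (complexBetti.map σ (2 * 1) (complexBetti.map π (2 * 1) x)) +
      c • complexGysin μ hW hS π (rfl : 2 * 1 + 2 * 2 = 2 * 1 + 2 * 2)
        (complexBetti.map σ' (2 * 1) (complexBetti.map π (2 * 1) x)) := fun x => by
    rw [hT, complexBetti_map_comp_apply, complexBetti_map_comp_apply]
  have h1' : ∀ x, complexBetti.map π (2 * 1) (T x) =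
      complexBetti.map σ (2 * 1) (complexBetti.map π (2 * 1) x) +
        complexBetti.map σ' (2 * 1) (complexBetti.map π (2 * 1) x) := fun x => by
    rw [h1, complexBetti_map_comp_apply, complexBetti_map_comp_apply]
  refine ⟨fun x y => hecke_cup_selfAdjoint (cupProduct (rfl : 2 * 1 + 2 * 1 = 2 * 2))
      (cupProduct (rfl : 2 * 1 + 2 * 1 = 2 * 2)) T (complexBetti.map π (2 * 1)).hom
      (complexBetti.map σ (2 * 1)).hom (complexBetti.map σ' (2 * 1)).hom
      (complexBetti.map σ (2 * 2)).hom (complexBetti.map σ' (2 * 2)).hom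
      (complexGysin μ hW hS π (rfl : 2 * 1 + 2 * 2 = 2 * 1 + 2 * 2))
      (complexGysin μ hW hS π (rfl : 2 * 2 + 2 * 2 = 2 * 2 + 2 * 2)) c hT'
      (complexBetti_map_map_of_comp_eq_id hσσ' (2 * 1))
      (complexBetti_map_map_of_comp_eq_id hσ'σ (2 * 1)) hσ4 hσ'4
      (fun x w => (complexGysin_cup hμ hW hS π (rfl : 2 * 1 + 2 * 1 = 2 * 2)
        (rfl : 2 * 2 + 2 * 2 = 2 * 2 + 2 * 2) (rfl : 2 * 1 + 2 * 2 = 2 * 1 + 2 * 2)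
        (rfl : 2 * 1 + 2 * 1 = 2 * 2) x w).symm)
      cupProduct_comm_two_two cupProduct_comm_two_two
      (fun a b => complexBetti_map_cupProduct σ (rfl : 2 * 1 + 2 * 1 = 2 * 2) a b)
      (fun a b => complexBetti_map_cupProduct σ' (rfl : 2 * 1 + 2 * 1 = 2 * 2) a b) x y,
    fun x hx => hecke_sq_eq_two_smul_of_transfer T (complexBetti.map π (2 * 1)).hom
      (complexBetti.map σ (2 * 1)).hom (complexBetti.map σ' (2 * 1)).hom
      (complexGysin μ hW hS π (rfl : 2 * 1 + 2 * 2 = 2 * 1 + 2 * 2)) c hT'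
      (complexBetti_map_map_of_comp_eq_id hσσ' (2 * 1))
      (complexBetti_map_map_of_comp_eq_id hσ'σ (2 * 1)) h1' h2 x hx⟩

end HeckeAlgebra

end Summit.HodgeConjecture.HodgeConjecture.Theorems.NikulinTwinTransport

end
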